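import Mathlib
import Summits.NavierStokesRegularity.NavierStokesRegularity.Theorems.TaoLadderRungTwoBreakOneShiftWindowK1GlueC
import Summits.NavierStokesRegularity.NavierStokesRegularity.Theorems.TaoLadderRungTwoBreakOneShiftWindowTermEncl
import HarnessLib

/-!
# The one-shift window system, LIV: THE FRAME-LEVEL GLUE TO THE `g`-HULL CLAUSE (`hgl`) FOR THE CENTRED GRID — every
# admissible point's window run, at its own flight time, has renormalisation factor `g = (Σ_i z_{i,1}²)^{-1/2}` inside the
# box `G` of the Krawczyk datum (the same `gCert` over the energy box of the final hull `Zb ⊇ Hs_S` that the (K1) link already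
# checks); so `G ⊆ [gLo, gHi]` — two dyadic comparisons — gives the clause `hgl` of the certificate side for the constructed
# certificate (`fullFamily (windowCertOfMatrix …) w = windowRunMap (preclampY w) (preclampTail w)`, `decodeTau w = preclampTau w`)
# (cell harvest/h2-tao-ladder, seat p2; rung1/KERNEL-CHEAP-REPLAY-SPEC.md §3 S5, §9; support for K1(1) = `NoSurvivingDSSOne`,
# stmt-NavierStokesRegularity-20205)

MODEL lattice ODEs only (Tao 2016 §4 normal form on Tao's shift set `S`); nothing here is a statement about
the Navier–Stokes equations; no item is closed; no instance is evaluated here.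

* `TermPresD.hRD_of_frames'` — part XLVII's `hRD_of_frames` for EVERY point of trajectory space (pre-clamped tails lie in the
  tubes whether or not the point is admissible), the form the hull clauses (quantified over `Adm`, not `AdmLip`) consume;
* `OneShiftFrame.adm_zeroWin`; `gfac_mem_of_gridC` (`g ∈ G` for every `Adm` point); `gl_of_gridC` (**`hgl` with `[gLo, gHi] ⊇ G`**).
-/

noncomputable section

-- the sub-problem namespace repeats the summit name by design (D-0017)
set_option linter.dupNamespace false

namespace Summit.NavierStokesRegularity.NavierStokesRegularity.Theorems

namespace DSSOneShift

open Set Finset Metric Filter Topology TopologicalSpace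
open Literature.Analysis.ODE Literature.Analysis.FluidPDE Literature.Analysis.FluidPDE.TaoCascade
open Summit.NavierStokesRegularity.NavierStokesRegularity.Theorems.TaylorModelCert
open Summit.NavierStokesRegularity.NavierStokesRegularity.Theorems.TaylorModelReadout
open Summit.NavierStokesRegularity.NavierStokesRegularity.Theorems.CertificateGlueOn

variable {m : ℕ}

/-! ### The term data present EVERY point's realisation -/

namespace TermPresD

variable {P : TermPresD m} {F : OneShiftFrame m} {ε₀ : ℝ} {α : Fin m → Fin m → Fin m → ℤ × ℤ × ℤ → ℝ}

/-- **`hRD` for every point of trajectory space** (the pre-clamp puts the tails in the tubes at all times, admissible or not).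
[cite: Tao2016AveragedNS, §4 (4.8); cell vocabulary, harvest/h2-tao-ladder rung1/KERNEL-CHEAP-REPLAY-SPEC.md §9 (I)] -/
theorem hRD_of_frames' {g : GridD} {e : F.SIdx ≃ Fin g.n} (hn : ∀ s, (g.step s).n = g.n) (hPn : P.n = g.n)
    (S : P.Frames F ε₀ α (e.trans (finCongr hPn.symm))) (hchk : P.check = true)
    (hRD : ∀ s ≤ g.S, (g.step s).RD = P.mkRD) :
    ∀ u : F.Space, ∀ s ≤ g.S, ∀ r ∈ Ico 0 (g.h s).toReal,
      IsRTEncl (g.es e hn s) (centreList F ε₀ α) (F.wterms ε₀ α (F.preclampTail u) (g.t s + r)) (P.rowsOf F)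
        (g.step s).RD := by
  intro u s hs r _
  rw [hRD s hs]
  refine IsRTEncl.of_val_eq (isRTEncl_wterms S hchk fun i k hk => ?_) fun i => by simp
  unfold OneShiftFrame.preclampTail OneShiftFrame.clampTail
  rw [if_neg hk]
  have hw := F.wt_pos k
  set x := (u.2.2 : F.TailIdx → ℝ) (i, k, projIcc 0 F.τhi F.τhi_pos.le (g.t s + r)) with hx
  have hlo : (F.tubeC i k - F.tubeR k) / F.wt k ≤ max ((F.tubeC i k - F.tubeR k) / F.wt k)
      (min ((F.tubeC i k + F.tubeR k) / F.wt k) x) := le_max_left _ _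
  have hhi : max ((F.tubeC i k - F.tubeR k) / F.wt k) (min ((F.tubeC i k + F.tubeR k) / F.wt k) x) ≤
      (F.tubeC i k + F.tubeR k) / F.wt k :=
    max_le (by gcongr; linarith [F.tubeR_nonneg k]) (min_le_left _ _)
  rw [abs_le]
  rw [div_le_iff₀ hw] at hlo
  rw [le_div_iff₀ hw] at hhi
  constructor <;> nlinarith [hlo, hhi]

end TermPresD

namespace OneShiftFrame

variable (F : OneShiftFrame m)

/-- The reference point of an admissible point is admissible. [folklore] -/
theorem adm_zeroWin {u : F.Space} (hu : F.Adm u) : F.Adm (F.zeroWin u) :=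
  ⟨fun i k => by simp [zeroWin], hu.2.1, hu.2.2.1, hu.2.2.2.1, hu.2.2.2.2⟩

section Glue

variable {ε₀ : ℝ} {α : Fin m → Fin m → Fin m → ℤ × ℤ × ℤ → ℝ} {R : ℤ → ℝ}
variable {g : GridCD} {kd : KrawD} {e : F.SIdx ≃ Fin g.n}
variable {κ : Type*} [Fintype κ]

/-- **THE RENORMALISATION FACTOR OF EVERY ADMISSIBLE RUN AT ITS FLIGHT TIME LIES IN `G`.** [cite: Tao2016AveragedNS, §5.3; Moore1979, §3.2 and §8.1; cell vocabulary, harvest/h2-tao-ladder rung1/RUNG1-P2G9-REPORT.md §37 (hgl)] -/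
theorem gfac_mem_of_gridC (hε : 0 ≤ ε₀) (hα : IsCancellingCoeff α)
    (hEb : ∀ i, |F.tubeC i (-1)| + F.tubeR (-1) ≤ F.Eb) (hEt : ∀ i, |F.tubeC i F.W| + F.tubeR F.W ≤ F.Et)
    (M : F.FrameMatch g.toGridD kd e R) (hkn : kd.rs.n = g.n)
    (Tc : ℕ → κ → BTerm F.SIdx) (rows : F.SIdx → List κ) (Tf : F.Space → ℝ → κ → BTerm F.SIdx)
    (hTf : ∀ u t x, termField (Tf u t) x = F.wfieldFlat ε₀ α (F.preclampTail u) t x)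
    (hRDc : ∀ s ≤ g.S, IsRTEncl (g.es e M.hn s) (Tc s) (Tc s) rows (g.step s).RD)
    (hRD : ∀ u : F.Space, ∀ s ≤ g.S, ∀ r ∈ Ico 0 (g.h s).toReal,
      IsRTEncl (g.es e M.hn s) (Tc s) (Tf u (g.t s + r)) rows (g.step s).RD)
    (hstep : ∀ s ≤ g.S, g.stepOK s = true) (hinit : g.initOK = true) (hprod : ∀ s ≤ g.S, g.prodOK s = true)
    (hpwf : ∀ s ≤ g.S, g.pwfOK s = true) (hpsub : ∀ s ≤ g.S, g.psubOK s = true)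
    (hplink : ∀ s < g.S, g.plinkOK s = true) (hwlink : ∀ s < g.S, g.wlinkOK s = true) (hK1 : g.linkK1 kd = true)
    (hP0 : (fun c : F.SIdx => F.yc c.1 ((c.2 : ℕ) : ℤ)) ∈ boxSet (boxOf e (g.P 0)))
    {w : F.Space} (hw : F.Adm w) :
    IntervalD.mem (gfac (slice (F.windowRunMap ε₀ α (F.preclampY w) (F.preclampTail w)) (F.preclampTau w))) kd.rs.G := by
  classical
  have hW1 := M.hW1
  have hn := M.hn
  have hW : 0 < F.W := lt_trans zero_lt_one hW1
  obtain ⟨-, hZb, -, -, he0, hG, -, -⟩ := g.of_linkK1 hK1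
  set ek : F.SIdx ≃ Fin kd.rs.n := e.trans (finCongr hkn.symm) with hekdef
  have hek : ∀ p : F.SIdx, ((ek p : Fin kd.rs.n) : ℕ) = (e p : ℕ) := fun p => by simp [hekdef]
  -- facts of the final step
  have hchkS : (g.step g.S).check = true := by
    have := hstep g.S le_rfl
    simp only [GridD.stepOK, Bool.and_eq_true, decide_eq_true_eq] at this
    exact this.1
  have hc' : (g.step g.S).toRoughStepD.check = true ∧ (g.step g.S).checkPair = true := by
    simpa [PairStepD.check, Bool.and_eq_true] using hchkS
  have hrc' : (g.step g.S).toRoughStepD.centre.check = true ∧ (g.step g.S).toRoughStepD.checkKZ = true := by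
    simpa [RoughStepD.check, Bool.and_eq_true] using hc'.1
  obtain ⟨heta, hKZ⟩ := (g.step g.S).toRoughStepD.of_checkKZ hrc'.2
  have hcw := (g.step g.S).toRoughStepD.centre.of_checkWith (by rw [← CentreStepD.check_eq]; exact hrc'.1)
  have hwfS : ∀ c < (g.step g.S).n, wfsD (IntervalD.aget (g.step g.S).S c) = true := fun c hc => (hcw.2.2.1 c hc).2.1
  have hZ : ∀ c < (g.step g.S).n, 0 ≤ (RoughStepD.dget (g.step g.S).Zh c).toReal := fun c hc => (hKZ c hc).1
  have hHsZb : ∀ x ∈ boxSet (boxOf e (g.step g.S).Hs), ∀ c, IntervalD.mem (x c) (IntervalD.aget kd.rs.Zb (ek c)) := by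
    intro x hx c
    have hx' : x ∈ boxSet (boxOf (g.es e hn g.S) (g.step g.S).Hs) := by rw [GridD.boxOf_es]; exact hx
    have h := (g.step g.S).toRoughStepD.mem_of_mem_Hs (g.es e hn g.S) hwfS hZ heta hx' c
    rw [GridD.es_val] at h
    rw [hek]
    exact IntervalD.mem_of_subset (hZb _ (e c).isLt) h
  -- the run of `w` and the reference run
  set Sw := F.windowRunMap ε₀ α (F.preclampY w) (F.preclampTail w) with hSwdef
  have hSw : F.IsRunFrom ε₀ α (F.preclampY w) (F.preclampTail w) Sw := F.isRunFrom_windowRunMap hε hW hα hEb hEt hw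
  have hfw : ∀ t ∈ Icc 0 F.τhi, HasDerivWithinAt (F.flatRun Sw) (termField (Tf w t) (F.flatRun Sw t)) (Icc 0 F.τhi) t := by
    intro t ht
    have h := F.hasDerivWithinAt_flatRun hSw ht
    rwa [← hTf w t] at h
  set Sc := F.windowRunMap ε₀ α (F.preclampY (F.zeroWin w)) (F.preclampTail (F.zeroWin w)) with hScdef
  have hSc : F.IsRunFrom ε₀ α (F.preclampY (F.zeroWin w)) (F.preclampTail (F.zeroWin w)) Sc :=
    F.isRunFrom_windowRunMap hε hW hα hEb hEt (F.adm_zeroWin hw)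
  have hfc : ∀ t ∈ Icc 0 F.τhi, HasDerivWithinAt (F.flatRun Sc) (termField (Tf w t) (F.flatRun Sc t)) (Icc 0 F.τhi) t := by
    intro t ht
    have h := F.hasDerivWithinAt_flatRun hSc ht
    rwa [F.preclampTail_zeroWin, ← hTf w t] at h
  have hSc0 : F.flatRun Sc 0 = fun c : F.SIdx => F.yc c.1 ((c.2 : ℕ) : ℤ) := funext fun c => F.flatRun_zeroWin_zero hSc c
  have ha : F.flatRun Sw 0 ∈ boxSet (boxOf e (g.step 0).W) := M.hW0 _ fun c => F.abs_flatRun_zero_sub_yc_le hSw c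
  -- times
  have hτc := F.τc_gt
  have hrτ := F.rτ_pos
  have htS' : g.t g.S ≤ F.τhi := M.htS.trans (by unfold τhi; linarith)
  have hTS' : F.τhi ≤ g.t g.S + (g.h g.S).toReal := M.hTS.le
  have hτw := F.preclampTau_mem_box w
  have hτw' : F.preclampTau w ∈ Icc (g.t g.S) F.τhi := ⟨M.htS.trans hτw.1, hτw.2⟩
  -- the grid: the run is in the final hull at its flight time
  obtain ⟨-, hhull⟩ := g.exists_flowSlope_of_gridC_upto e hn hRDc (hRD w) hstep hinit hprod hpwf hpsub hplink hwlink htS'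
    hTS' hP0 hSc0 hfc ha ha (Su := F.flatRun Sw) (Sv := F.flatRun Sw) rfl rfl hfw hfw
  have hz1 : ∀ i : Fin m, IntervalD.mem (Sw i 1 (F.preclampTau w)) (IntervalD.aget kd.rs.Zb (ek (i, ⟨1, hW1⟩))) := fun i => by
    have h := hHsZb _ (hhull _ hτw').1 (i, ⟨1, hW1⟩)
    simpa [flatRun] using h
  have hidx1' : ∀ i : Fin m, ResSlopeD.natget kd.rs.idx1 i = (ek (i, ⟨1, hW1⟩) : ℕ) := fun i => by rw [hek]; exact M.hidx1 i
  have hE := ResSlopeD.mem_energyBox_of ek hW1 M.hm hidx1' (z := slice Sw (F.preclampTau w)) (fun i => by simpa using hz1 i)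
  unfold gfac
  exact mem_rsqrt_of_gCert hG he0 ⟨hE.1, hE.2⟩

/-- **THE `g`-HULL CLAUSE FROM THE CENTRED GRID**: with the hypotheses of `gfac_mem_of_gridC` and the two comparisons
`gLo ≤ G.lo`, `G.hi ≤ gHi`, every admissible point's run has `gLo ≤ g ≤ gHi` at its flight time (the all-runs form of
`hgl`, part VI `gl_of_runs`, specialised to the window-run map). [cite: Tao2016AveragedNS, §5.3; cell vocabulary, harvest/h2-tao-ladder rung1/RUNG1-P2G9-REPORT.md §37 (hgl)] -/
theorem gl_of_gridC (hε : 0 ≤ ε₀) (hα : IsCancellingCoeff α)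
    (hEb : ∀ i, |F.tubeC i (-1)| + F.tubeR (-1) ≤ F.Eb) (hEt : ∀ i, |F.tubeC i F.W| + F.tubeR F.W ≤ F.Et)
    (M : F.FrameMatch g.toGridD kd e R) (hkn : kd.rs.n = g.n)
    (Tc : ℕ → κ → BTerm F.SIdx) (rows : F.SIdx → List κ) (Tf : F.Space → ℝ → κ → BTerm F.SIdx)
    (hTf : ∀ u t x, termField (Tf u t) x = F.wfieldFlat ε₀ α (F.preclampTail u) t x)
    (hRDc : ∀ s ≤ g.S, IsRTEncl (g.es e M.hn s) (Tc s) (Tc s) rows (g.step s).RD)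
    (hRD : ∀ u : F.Space, ∀ s ≤ g.S, ∀ r ∈ Ico 0 (g.h s).toReal,
      IsRTEncl (g.es e M.hn s) (Tc s) (Tf u (g.t s + r)) rows (g.step s).RD)
    (hstep : ∀ s ≤ g.S, g.stepOK s = true) (hinit : g.initOK = true) (hprod : ∀ s ≤ g.S, g.prodOK s = true)
    (hpwf : ∀ s ≤ g.S, g.pwfOK s = true) (hpsub : ∀ s ≤ g.S, g.psubOK s = true)
    (hplink : ∀ s < g.S, g.plinkOK s = true) (hwlink : ∀ s < g.S, g.wlinkOK s = true) (hK1 : g.linkK1 kd = true)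
    (hP0 : (fun c : F.SIdx => F.yc c.1 ((c.2 : ℕ) : ℤ)) ∈ boxSet (boxOf e (g.P 0)))
    {gLo gHi : ℝ} (hGlo : gLo ≤ kd.rs.G.lo.toReal) (hGhi : kd.rs.G.hi.toReal ≤ gHi) :
    ∀ w, F.Adm w →
      gLo ≤ gfac (slice (F.windowRunMap ε₀ α (F.preclampY w) (F.preclampTail w)) (F.preclampTau w)) ∧
      gfac (slice (F.windowRunMap ε₀ α (F.preclampY w) (F.preclampTail w)) (F.preclampTau w)) ≤ gHi := by
  intro w hw
  have h := F.gfac_mem_of_gridC hε hα hEb hEt M hkn Tc rows Tf hTf hRDc hRD hstep hinit hprod hpwf hpsub hplink hwlink hK1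
    hP0 hw
  exact ⟨hGlo.trans h.1, h.2.trans hGhi⟩

end Glue

end OneShiftFrame

end DSSOneShift

end Summit.NavierStokesRegularity.NavierStokesRegularity.Theorems
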